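import Mathlib
import Summits.Ventures.HodgeRepro.Tier4.Target
import Summits.Ventures.HodgeRepro.Tier4.Line3.KMDatumS
import Summits.Ventures.HodgeRepro.Tier4.Line3.Defs
import Summits.Ventures.HodgeRepro.Tier4.Line3.MajorantLemmas

/-!
# Tier4/Line3/KernelBound — the quadruple kernel is a polynomial times the four Gaussians (rung for L3.4 / L3.5)

Blind re-derivation cell `pub-hodge-repro`, Tier 4 «PROVE THE STEP» (README §9–§10), LINE L3, seat t4-L2-p3 on L3.5
`term_dominated` (lead S12234).

The datum `datumS Φ y z k = (ȳ ⬝ A z k y) · e^{−π maj(y, z)}` (Skeleton v0.14, `KMDatumS`) is bounded by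
`aNorm Φ z k · (Σ_i ‖y i‖)² · e^{−π maj(y, z)}` with `aNorm Φ z k = Σ_{i,j} ‖A z k i j‖` (`norm_datumS_le`), so the
quadruple kernel `kernel Φ x z = (Φ(y₀) ∧ Φ(y₁)) · conj (Φ(y₂) ∧ Φ(y₃))` (`y_j = ballCoord (x j)`) is bounded by
`(aNorm Φ z 0 + aNorm Φ z 1)⁴ · ∏_j (Σ_i ‖y_j i‖)² · ∏_j e^{−π maj(y_j, z)}` (`norm_kernel_le`, through L2-p1's
`norm_wedge_le`).  With `KMDatumS.growth` the prefactor is `≤ 18 C / (1 − nsq z)^m` (`aNorm_le`).  The four Gaussians are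
what R4 (`Majorant.rung_gaussian_small`, through `SylvesterTransfer`) and the definite-place bound (`DefiniteBound`)
act on in step 5.

Nothing here asserts anything about the truth of (P); HC_CM is NOT proved by anyone in this repository.
-/

set_option autoImplicit false

noncomputable section

namespace Summit.Ventures.HodgeRepro.Tier4.Line3

open Matrix
open scoped ComplexConjugate

/-- The entry-sum norm `Σ_{i,j} ‖A z k i j‖` of the datum's coefficient matrix. -/
def aNorm (Φ : KMDatumS) (z : Fin 2 → ℂ) (k : Fin 2) : ℝ := ∑ i, ∑ j, ‖Φ.A z k i j‖

/-- `aNorm ≥ 0`. -/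
theorem aNorm_nonneg (Φ : KMDatumS) (z : Fin 2 → ℂ) (k : Fin 2) : 0 ≤ aNorm Φ z k :=
  Finset.sum_nonneg fun _ _ => Finset.sum_nonneg fun _ _ => norm_nonneg _

/-- `‖ȳ ⬝ A y‖ ≤ aNorm · (Σ_i ‖y i‖)²`. -/
theorem norm_star_dotProduct_mulVec_le (A : Matrix (Fin 3) (Fin 3) ℂ) (y : Fin 3 → ℂ) :
    ‖star y ⬝ᵥ (A *ᵥ y)‖ ≤ (∑ i, ∑ j, ‖A i j‖) * (∑ i, ‖y i‖) ^ 2 := by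
  have hexp : star y ⬝ᵥ (A *ᵥ y) = ∑ i, ∑ j, conj (y i) * A i j * y j := by
    simp only [dotProduct, Matrix.mulVec, Pi.star_apply, Complex.star_def, Finset.mul_sum, mul_assoc]
  rw [hexp]
  have hterm : ∀ i j, ‖conj (y i) * A i j * y j‖ ≤ ‖A i j‖ * (∑ i, ‖y i‖) ^ 2 := by
    intro i j
    rw [norm_mul, norm_mul, Complex.norm_conj]
    have h1 : ‖y i‖ ≤ ∑ i, ‖y i‖ := Finset.single_le_sum (f := fun i => ‖y i‖) (fun i _ => norm_nonneg _) (Finset.mem_univ i)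
    have h2 : ‖y j‖ ≤ ∑ i, ‖y i‖ := Finset.single_le_sum (f := fun i => ‖y i‖) (fun i _ => norm_nonneg _) (Finset.mem_univ j)
    have hA := norm_nonneg (A i j)
    have hyi := norm_nonneg (y i)
    have hyj := norm_nonneg (y j)
    calc ‖y i‖ * ‖A i j‖ * ‖y j‖ = ‖A i j‖ * (‖y i‖ * ‖y j‖) := by ring
      _ ≤ ‖A i j‖ * ((∑ i, ‖y i‖) * (∑ i, ‖y i‖)) :=
        mul_le_mul_of_nonneg_left (mul_le_mul h1 h2 hyj (Finset.sum_nonneg fun i _ => norm_nonneg _)) hA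
      _ = ‖A i j‖ * (∑ i, ‖y i‖) ^ 2 := by ring
  calc ‖∑ i, ∑ j, conj (y i) * A i j * y j‖ ≤ ∑ i, ∑ j, ‖conj (y i) * A i j * y j‖ :=
        (norm_sum_le _ _).trans (Finset.sum_le_sum fun i _ => norm_sum_le _ _)
    _ ≤ ∑ i, ∑ j, ‖A i j‖ * (∑ i, ‖y i‖) ^ 2 :=
        Finset.sum_le_sum fun i _ => Finset.sum_le_sum fun j _ => hterm i j
    _ = (∑ i, ∑ j, ‖A i j‖) * (∑ i, ‖y i‖) ^ 2 := by simp only [Finset.sum_mul]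

/-- **THE DATUM IS BOUNDED BY A POLYNOMIAL TIMES THE GAUSSIAN.** -/
theorem norm_datumS_le (Φ : KMDatumS) (y : Fin 3 → ℂ) (z : Fin 2 → ℂ) (k : Fin 2) :
    ‖datumS Φ y z k‖ ≤ aNorm Φ z k * (∑ i, ‖y i‖) ^ 2 * Real.exp (-Real.pi * maj y z) := by
  unfold datumS
  rw [norm_mul, Complex.norm_real, Real.norm_eq_abs, abs_of_pos (Real.exp_pos _)]
  exact mul_le_mul_of_nonneg_right (norm_star_dotProduct_mulVec_le _ _) (Real.exp_pos _).le

/-- The two components of the datum together: `‖Φ(y)₀‖ + ‖Φ(y)₁‖ ≤ (aNorm z 0 + aNorm z 1) (Σ‖y i‖)² e^{−π maj}`. -/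
theorem norm_datumS_sum_le (Φ : KMDatumS) (y : Fin 3 → ℂ) (z : Fin 2 → ℂ) :
    ‖datumS Φ y z 0‖ + ‖datumS Φ y z 1‖ ≤
      (aNorm Φ z 0 + aNorm Φ z 1) * ((∑ i, ‖y i‖) ^ 2 * Real.exp (-Real.pi * maj y z)) := by
  have h0 := norm_datumS_le Φ y z 0
  have h1 := norm_datumS_le Φ y z 1
  rw [add_mul]
  linarith [h0, h1]

namespace T4Data

variable (X : T4Data)

/-- **THE KERNEL BOUND.** `‖kernel Φ x z‖ ≤ (aNorm z 0 + aNorm z 1)⁴ · ∏_j (Σ_i ‖y_j i‖)² · ∏_j e^{−π maj(y_j, z)}` with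
`y_j = ballCoord (x j)`. -/
theorem norm_kernel_le (Φ : KMDatumS) (x : X.Tuple) (z : Fin 2 → ℂ) :
    ‖X.kernel Φ x z‖ ≤ (aNorm Φ z 0 + aNorm Φ z 1) ^ 4 *
      ∏ j, ((∑ i, ‖X.ballCoord (x j) i‖) ^ 2 * Real.exp (-Real.pi * maj (X.ballCoord (x j)) z)) := by
  unfold kernel
  rw [norm_mul, Complex.norm_conj]
  set a := aNorm Φ z 0 + aNorm Φ z 1 with ha
  have ha0 : 0 ≤ a := add_nonneg (aNorm_nonneg _ _ _) (aNorm_nonneg _ _ _)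
  set g : Fin 4 → ℝ := fun j => (∑ i, ‖X.ballCoord (x j) i‖) ^ 2 * Real.exp (-Real.pi * maj (X.ballCoord (x j)) z)
    with hg
  have hg0 : ∀ j, 0 ≤ g j := fun j => mul_nonneg (sq_nonneg _) (Real.exp_pos _).le
  have hw : ∀ j j', ‖wedge (datumS Φ (X.ballCoord (x j)) z) (datumS Φ (X.ballCoord (x j')) z)‖ ≤
      (a * g j) * (a * g j') := by
    intro j j'
    refine (IntegrableMajorant.norm_wedge_le _ _).trans ?_
    exact mul_le_mul (norm_datumS_sum_le Φ _ z) (norm_datumS_sum_le Φ _ z) (by positivity) (by positivity)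
  calc ‖wedge (datumS Φ (X.ballCoord (x 0)) z) (datumS Φ (X.ballCoord (x 1)) z)‖ *
        ‖wedge (datumS Φ (X.ballCoord (x 2)) z) (datumS Φ (X.ballCoord (x 3)) z)‖
      ≤ ((a * g 0) * (a * g 1)) * ((a * g 2) * (a * g 3)) :=
        mul_le_mul (hw 0 1) (hw 2 3) (norm_nonneg _) (by positivity)
    _ = a ^ 4 * ∏ j, g j := by
        rw [Fin.prod_univ_four]
        ring

/-- With `KMDatumS.growth`, `aNorm Φ z k ≤ 9 C / (1 − nsq z)^m` on the ball. -/
theorem aNorm_le (Φ : KMDatumS) (z : Fin 2 → ℂ) (hz : z ∈ ball) (k : Fin 2) {C m : ℝ}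
    (hCm : ∀ z ∈ ball, ∀ k i j, ‖Φ.A z k i j‖ ≤ C / (1 - nsq z) ^ m) :
    aNorm Φ z k ≤ 9 * (C / (1 - nsq z) ^ m) := by
  unfold aNorm
  calc ∑ i, ∑ j, ‖Φ.A z k i j‖ ≤ ∑ i : Fin 3, ∑ j : Fin 3, C / (1 - nsq z) ^ m :=
        Finset.sum_le_sum fun i _ => Finset.sum_le_sum fun j _ => hCm z hz k i j
    _ = 9 * (C / (1 - nsq z) ^ m) := by simp [Finset.sum_const]; ring

end T4Data

end Summit.Ventures.HodgeRepro.Tier4.Line3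

end
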